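import Mathlib
import HarnessLib
import Literature.MathematicalPhysics.QuantumLattice.HubbardEffectiveActionCTTimeReversal
import Summits.HubbardSuperconductivity.HubbardSuperconductivity.Theorems.KLProgrammeKLRegimeEngineV8PairTransferExport2
import Summits.HubbardSuperconductivity.HubbardSuperconductivity.Theorems.KLProgrammeKLRegimeSplitEdgeFacts

/-!
# Route `KLProgramme` — ENGINE child gen 8 (stmt-HubbardSuperconductivity-20437 `KLRegimeEngineV17F2`), skeleton v2 class #5 «(S)-transfer» rev 2
# (`…EngineV8PairTransferExport2`, p576787): the ALGEBRA of the pinned transfer weight — named pair masses, bilinearity, the two CONSERVATION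
# IDENTITIES of (R54)(ii), realness (cell gate-hubbard-kl, seat hubbard-kl-p1 g11; model bookkeeping of the EdgeFacts lane, no estimates)

WHY.  (R54) pins class #5's transfer weight as the model function `klTransferWeight … n φ` and books to the p1 lineage (ii): its mass / sign MODEL LINES and
the two CONSERVATION IDENTITIES the composition uses — `t_{n,m} = t_{n−1,m} + w − w₁^{(m)}` (re-export of a member through `pairTransferFwd_succ_klPairArrayF`,
whose output weight is `b′ + w − w₁` EXACTLY) and `w = w₁^{(n)} − t_{n−1,n}` (the (E2-F2) weight as the composite `w₁ − t` of
`pairLadderStepAtV17F2_of_pairTransferAtCov`, p546910).  Both are bilinearity of the Matsubara pair sum in the line symbols once the plain and the smeared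
slice weights are written in the SAME currency — which this file does:
* §1 `klBubbleSum β μ K a b Qm p = Σ_ν a(ν,p)·b(−ν,Qm−p)·ĝ_K(ν,p)·ĝ_K(−ν,Qm−p)` (two weight symbols, not symmetrised), `klBubbleMass = (βL²)⁻¹·Re klBubbleSum`
  (the `z′` currency of `pairLadderStepAtV8_of_expansion`: normalised loop sum, line values `weight·ĝ_K`); additivity in each symbol;
  **`klTransferWeight_eq_neg_bubbleMass`**: `t_n[φ] = −(B(w_{Λ_n}, φ) + B(φ, w_{Λ_n}))`.
* §2 `klSliceWeightPlain … n = B(w_{Λ_n}, w_{Λ_n}) − B(w_{Λ_{n−1}}, w_{Λ_{n−1}})` (the plain slice weight `w_n`), `klSliceWeightSmeared … n φ = B(φ + s_n, φ + s_n) − B(φ, φ)`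
  (the smeared slice weight `w₁^{(φ)}` of the member `φ`: rungs `g⊗g + g⊗S_φ + S_φ⊗g`, `s_n = softSymbolCompl (n−1) n` the slice symbol);
  **`klTransferWeight_succ`** (identity 1: `t_{n+1}[φ] = t_n[φ + s_{n+1}] + w_{n+1} − w₁^{(φ)}_{n+1}`) and **`klSliceWeightPlain_succ_eq`** (identity 2:
  `w_{n+1} = w₁^{(0)}_{n+1} − t_n[s_{n+1}]`).
* §3 `propCT_revFreq` (`ĝ_K(−ν,k) = conj ĝ_K(ν,k)`), **`klBubbleSum_im_eq_zero`** (even symbols ⇒ real pair sum), **`klTransferWeight_ofReal_eq`** (for an even `φ` the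
  pinned weight IS `−(βL²)⁻¹·(S(w,φ) + S(φ,w))` as a complex number — the `Re` in its definition loses nothing on `IsSoftSymbol`).
The mass line `Σ_p |t| ≤ G.bhi/4` and the sign line `Σ_p (|t| + t) ≤ klEdge G n |Qm|_𝕋` (estimates) are the next file of the lane.  Proved; no `sorry`; nothing about the
model is asserted beyond exact identities.  0 kit.
-/
noncomputable section

namespace Summit.HubbardSuperconductivity.HubbardSuperconductivity.Theorems.KLRegimeSplit

set_option linter.dupNamespace false -- summit = problem name (single-conjunct summit), D-0017

open Real Finset Literature.MathematicalPhysics.QuantumLattice Literature.Probability.LatticeModels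
open Literature.MathematicalPhysics.QuantumLattice.FermiRG
open Summit.HubbardSuperconductivity.HubbardSuperconductivity.Theorems.KLProgrammeLegKernels
open Summit.HubbardSuperconductivity.HubbardSuperconductivity.Theorems.TwoPointAssembly

/-! ## §1 The frequency-resolved pair sum and the pair mass of two weight symbols -/

section Bubble

variable (L M : ℕ)

/-- **The Matsubara pair sum of two weight symbols** `a, b` at pair class `Qm`, label `p`:
`klBubbleSum β μ K a b Qm p = Σ_ν a(ν,p)·b(−ν, Qm−p)·ĝ_K(ν,p)·ĝ_K(−ν, Qm−p)` (first line `a·ĝ_K` at `(ν,p)`, partner line `b·ĝ_K` at `(−ν, Qm−p)`; NOT symmetrised). -/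
def klBubbleSum (β μ : ℝ) (K : TrigPolyC4v) (a b : FreqMomentum L M → ℝ) (Qm p : TorusSite 2 L) : ℂ :=
  ∑ ν : MatsubaraIdx M, ((a (ν, p) * b (ν.rev, Qm - p) : ℝ) : ℂ) * (propCT L M β μ K (ν, p) * propCT L M β μ K (ν.rev, Qm - p))

/-- **The pair mass of two weight symbols**: `klBubbleMass β μ K a b Qm p = (βL²)⁻¹ · Re (klBubbleSum β μ K a b Qm p)` — the `z′` currency of
`pairLadderStepAtV8_of_expansion` (normalised loop sum `(βL²)⁻¹Σ_ν`, line values `weight·ĝ_K`). -/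
def klBubbleMass (β μ : ℝ) (K : TrigPolyC4v) (a b : FreqMomentum L M → ℝ) (Qm p : TorusSite 2 L) : ℝ :=
  (β * (L : ℝ) ^ 2)⁻¹ * (klBubbleSum L M β μ K a b Qm p).re

variable {L M} (β μ : ℝ) (K : TrigPolyC4v)

/-- Additivity of the pair sum in the first symbol. -/
theorem klBubbleSum_add_left (a a' b : FreqMomentum L M → ℝ) (Qm p : TorusSite 2 L) :
    klBubbleSum L M β μ K (a + a') b Qm p = klBubbleSum L M β μ K a b Qm p + klBubbleSum L M β μ K a' b Qm p := by
  unfold klBubbleSum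
  rw [← sum_add_distrib]
  refine sum_congr rfl fun ν _ => ?_
  simp only [Pi.add_apply]
  push_cast
  ring

/-- Additivity of the pair sum in the second symbol. -/
theorem klBubbleSum_add_right (a b b' : FreqMomentum L M → ℝ) (Qm p : TorusSite 2 L) :
    klBubbleSum L M β μ K a (b + b') Qm p = klBubbleSum L M β μ K a b Qm p + klBubbleSum L M β μ K a b' Qm p := by
  unfold klBubbleSum
  rw [← sum_add_distrib]
  refine sum_congr rfl fun ν _ => ?_
  simp only [Pi.add_apply]
  push_cast
  ring

/-- The pair sum vanishes for the zero first symbol … -/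
theorem klBubbleSum_zero_left (b : FreqMomentum L M → ℝ) (Qm p : TorusSite 2 L) : klBubbleSum L M β μ K 0 b Qm p = 0 := by
  simp [klBubbleSum]

/-- … and for the zero second symbol. -/
theorem klBubbleSum_zero_right (a : FreqMomentum L M → ℝ) (Qm p : TorusSite 2 L) : klBubbleSum L M β μ K a 0 Qm p = 0 := by
  simp [klBubbleSum]

/-- Additivity of the pair mass in the first symbol. -/
theorem klBubbleMass_add_left (a a' b : FreqMomentum L M → ℝ) (Qm p : TorusSite 2 L) :
    klBubbleMass L M β μ K (a + a') b Qm p = klBubbleMass L M β μ K a b Qm p + klBubbleMass L M β μ K a' b Qm p := by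
  simp only [klBubbleMass, klBubbleSum_add_left, Complex.add_re, mul_add]

/-- Additivity of the pair mass in the second symbol. -/
theorem klBubbleMass_add_right (a b b' : FreqMomentum L M → ℝ) (Qm p : TorusSite 2 L) :
    klBubbleMass L M β μ K a (b + b') Qm p = klBubbleMass L M β μ K a b Qm p + klBubbleMass L M β μ K a b' Qm p := by
  simp only [klBubbleMass, klBubbleSum_add_right, Complex.add_re, mul_add]

/-- **The pinned transfer weight is minus the symmetrised pair mass of the hard weight `w_{Λ_n}` and the symbol `φ`.** -/
theorem klTransferWeight_eq_neg_bubbleMass (n : ℕ) (φ : FreqMomentum L M → ℝ) (Qm p : TorusSite 2 L) :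
    klTransferWeight L M β μ K n φ Qm p =
      -(klBubbleMass L M β μ K (hubbardCutoffWeightCT L M β μ K (klScale klE0 n)) φ Qm p +
        klBubbleMass L M β μ K φ (hubbardCutoffWeightCT L M β μ K (klScale klE0 n)) Qm p) := by
  unfold klTransferWeight klBubbleMass klBubbleSum
  rw [← mul_add, ← Complex.add_re, ← sum_add_distrib]
  congr 3
  refine sum_congr rfl fun ν _ => ?_
  push_cast
  ring

end Bubble

/-! ## §2 The plain and the smeared slice weights in the same currency; the conservation identities -/

section Identities

variable (L M : ℕ)

/-- **The PLAIN slice weight of step `n`** in the `z′` currency: `w_n = b[H_n] − b[H_{n−1}]`, `b[X] = klBubbleMass w_X w_X` (the new rungs among hard lines when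
`H_{n−1}` grows to `H_n`; `w_0 = 0`). -/
def klSliceWeightPlain (β μ : ℝ) (K : TrigPolyC4v) (n : ℕ) (Qm p : TorusSite 2 L) : ℝ :=
  klBubbleMass L M β μ K (hubbardCutoffWeightCT L M β μ K (klScale klE0 n)) (hubbardCutoffWeightCT L M β μ K (klScale klE0 n)) Qm p -
    klBubbleMass L M β μ K (hubbardCutoffWeightCT L M β μ K (klScale klE0 (n - 1))) (hubbardCutoffWeightCT L M β μ K (klScale klE0 (n - 1))) Qm p

/-- **The SMEARED slice weight of step `n` for the member `φ`** (at scale `n`): `w₁^{(φ)} = b[S_φ + g_n] − b[S_φ]` — the rungs `g_n⊗g_n + g_n⊗S_φ + S_φ⊗g_n` the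
tower of the member adds along slice `n` (`s_n = w_{Λ_n} − w_{Λ_{n−1}}` the slice symbol). -/
def klSliceWeightSmeared (β μ : ℝ) (K : TrigPolyC4v) (n : ℕ) (φ : FreqMomentum L M → ℝ) (Qm p : TorusSite 2 L) : ℝ :=
  klBubbleMass L M β μ K (φ + softSymbolCompl L M β μ K (n - 1) n) (φ + softSymbolCompl L M β μ K (n - 1) n) Qm p -
    klBubbleMass L M β μ K φ φ Qm p

variable {L M} (β μ : ℝ) (K : TrigPolyC4v)

/-- The hard weight grows by the slice symbol: `w_{Λ_{n+1}} = w_{Λ_n} + s_{n+1}` (pointwise, by definition of `softSymbolCompl`). -/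
theorem hubbardCutoffWeightCT_succ_eq_add_compl (n : ℕ) :
    hubbardCutoffWeightCT L M β μ K (klScale klE0 (n + 1)) = hubbardCutoffWeightCT L M β μ K (klScale klE0 n) + softSymbolCompl L M β μ K n (n + 1) := by
  funext k
  simp only [Pi.add_apply, softSymbolCompl]
  ring

/-- **CONSERVATION IDENTITY 1 (re-export of a member by composition)**: for every symbol `φ` (the member of scale `n+1`) —
`t_{n+1}[φ] = t_n[φ + s_{n+1}] + w_{n+1} − w₁^{(φ)}_{n+1}`: the composite weight `b′ + w − w₁` of `pairTransferFwd_succ_klPairArrayF` (history weight `b′` of the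
scale-`n` member `φ + s_{n+1}`, plain slice weight `w`, smeared slice weight `w₁`) IS the pinned weight of the new member.  Pure bilinearity. -/
theorem klTransferWeight_succ (n : ℕ) (φ : FreqMomentum L M → ℝ) (Qm p : TorusSite 2 L) :
    klTransferWeight L M β μ K (n + 1) φ Qm p =
      klTransferWeight L M β μ K n (φ + softSymbolCompl L M β μ K n (n + 1)) Qm p + klSliceWeightPlain L M β μ K (n + 1) Qm p -
        klSliceWeightSmeared L M β μ K (n + 1) φ Qm p := by
  rw [klTransferWeight_eq_neg_bubbleMass, klTransferWeight_eq_neg_bubbleMass, klSliceWeightPlain, klSliceWeightSmeared, Nat.add_sub_cancel,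
    hubbardCutoffWeightCT_succ_eq_add_compl]
  simp only [klBubbleMass_add_left, klBubbleMass_add_right]
  ring

/-- **CONSERVATION IDENTITY 2 (the (E2-F2) weight from the complementary member)**: `w_{n+1} = w₁^{(0)}_{n+1} − t_n[s_{n+1}]` — the plain slice weight is the
smeared slice weight of the PLAIN target minus the pinned weight of the scale-`n` complementary member of index `n+1` (the composite `w₁ − t` of
`pairLadderStepAtV17F2_of_pairTransferAtCov`, p546910).  (= identity 1 at `φ = 0`, where `t_{n+1}[0] = 0`.) -/
theorem klSliceWeightPlain_succ_eq (n : ℕ) (Qm p : TorusSite 2 L) :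
    klSliceWeightPlain L M β μ K (n + 1) Qm p =
      klSliceWeightSmeared L M β μ K (n + 1) (fun _ => 0) Qm p - klTransferWeight L M β μ K n (softSymbolCompl L M β μ K n (n + 1)) Qm p := by
  have h := klTransferWeight_succ (L := L) (M := M) β μ K n (fun _ => 0) Qm p
  have h0 : klTransferWeight L M β μ K (n + 1) (fun _ => 0) Qm p = 0 := by simp [klTransferWeight]
  have hz : ((fun _ => (0 : ℝ)) : FreqMomentum L M → ℝ) + softSymbolCompl L M β μ K n (n + 1) = softSymbolCompl L M β μ K n (n + 1) := by
    funext k; simp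
  rw [h0, hz] at h
  linarith

end Identities

/-! ## §3 Realness: for EVEN symbols the pair sum is real, so the pinned weight IS the complex rung weight -/

section Realness

variable {L M : ℕ} (β μ : ℝ) (K : TrigPolyC4v)

/-- The frame propagator is conjugated by the frequency flip: `ĝ_K(−ν, k) = conj ĝ_K(ν, k)`. -/
theorem propCT_revFreq (ν : MatsubaraIdx M) (k : TorusSite 2 L) :
    propCT L M β μ K (ν.rev, k) = (starRingEnd ℂ) (propCT L M β μ K (ν, k)) := by
  simp only [propCT, matsubaraFreq_rev, map_div₀, map_one, map_add, map_mul, map_neg, Complex.conj_I, Complex.conj_ofReal]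
  push_cast
  ring

/-- **The pair sum of two EVEN symbols is real** (`ν ↦ −ν` pairs each term with its conjugate; `kled_sum_im_eq_zero_of_involutive`). -/
theorem klBubbleSum_im_eq_zero {a b : FreqMomentum L M → ℝ} (ha : ∀ k : FreqMomentum L M, a (k.1.rev, k.2) = a k)
    (hb : ∀ k : FreqMomentum L M, b (k.1.rev, k.2) = b k) (Qm p : TorusSite 2 L) :
    (klBubbleSum L M β μ K a b Qm p).im = 0 := by
  unfold klBubbleSum
  refine kled_sum_im_eq_zero_of_involutive Fin.rev Fin.rev_involutive _ fun ν => ?_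
  have ha' : a (ν.rev, p) = a (ν, p) := ha (ν, p)
  have hb' : b (ν.rev.rev, Qm - p) = b (ν.rev, Qm - p) := by rw [Fin.rev_rev, ← hb (ν, Qm - p)]
  rw [ha', hb', Fin.rev_rev, propCT_revFreq, map_mul, map_mul, Complex.conj_ofReal]
  have : propCT L M β μ K (ν, Qm - p) = (starRingEnd ℂ) (propCT L M β μ K (ν.rev, Qm - p)) := by
    rw [propCT_revFreq, Complex.conj_conj]
  rw [this]

/-- **For an even symbol the pinned weight IS (minus, normalised) the complex symmetrised pair sum** — no information is lost by the `Re` in its definition. -/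
theorem klTransferWeight_ofReal_eq {n : ℕ} {φ : FreqMomentum L M → ℝ} (hφ : ∀ k : FreqMomentum L M, φ (k.1.rev, k.2) = φ k) (Qm p : TorusSite 2 L) :
    (klTransferWeight L M β μ K n φ Qm p : ℂ) =
      -((((β * (L : ℝ) ^ 2)⁻¹ : ℝ) : ℂ) *
        (klBubbleSum L M β μ K (hubbardCutoffWeightCT L M β μ K (klScale klE0 n)) φ Qm p +
          klBubbleSum L M β μ K φ (hubbardCutoffWeightCT L M β μ K (klScale klE0 n)) Qm p)) := by
  have hχ : ∀ k : FreqMomentum L M, hubbardCutoffWeightCT L M β μ K (klScale klE0 n) (k.1.rev, k.2) = hubbardCutoffWeightCT L M β μ K (klScale klE0 n) k :=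
    fun k => by rw [hubbardCutoffWeightCT_revFreq]
  have hreal : (klBubbleSum L M β μ K (hubbardCutoffWeightCT L M β μ K (klScale klE0 n)) φ Qm p +
      klBubbleSum L M β μ K φ (hubbardCutoffWeightCT L M β μ K (klScale klE0 n)) Qm p).im = 0 := by
    rw [Complex.add_im, klBubbleSum_im_eq_zero β μ K hχ hφ, klBubbleSum_im_eq_zero β μ K hφ hχ, add_zero]
  rw [klTransferWeight_eq_neg_bubbleMass, klBubbleMass, klBubbleMass, ← mul_add, ← Complex.add_re]
  set S := klBubbleSum L M β μ K (hubbardCutoffWeightCT L M β μ K (klScale klE0 n)) φ Qm p +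
      klBubbleSum L M β μ K φ (hubbardCutoffWeightCT L M β μ K (klScale klE0 n)) Qm p with hS
  have hSre : ((S.re : ℝ) : ℂ) = S := by
    apply Complex.ext <;> simp [hreal]
  push_cast
  rw [hSre]

end Realness

end Summit.HubbardSuperconductivity.HubbardSuperconductivity.Theorems.KLRegimeSplit

end
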